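import Summits.QuantumFields.BalabanUV.Beta.EriceRemainderEnclosureHistoryAutonomyComparisonAgeCompositionAgeRatioWindowClusters

/-!
# EriceRemainderEnclosureHistoryAutonomyComparisonAgeCompositionFadingEnvelope — (E114a) route (N), first order: FADING MEMORY BUYS EVERY RANGE.
# The mass route is FINITE-RANGE over all admissible configurations ((E113c): the total window load is unbounded — two-age witnesses with `T(0) > 1`,
# `log`-growth for old-only profiles — and the next-row certificate (YO) of (E113b∕d) fails as well from `K ≈ 2·10⁶` on, README
# `HOME/b2b-balaban-beta-d4-p2/g94/README.md` §4–§5), and README g94 §4 names the right target: FINITE RANGE, then «the fading-memory corollary».  THIS IS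
# THAT COROLLARY.  A profile with an ENVELOPE from the age `kₑ` on — `L_k ≤ Λ_k` for `k ≥ kₑ`, in particular the GEOMETRIC envelope `L_k ≤ Cm·θ^k` of a
# fading memory (`MemoryProfile Cm θ`: the influence of the coupling of age `k` decays like `θ^k`) — has an old tail load
#     `Σ_{kₑ ≤ k < K} k·L_kh(m+k)³∕2 ≤ (γ³∕2)·Σ_{kₑ ≤ k < K} k·Λ_k ≤ ½·Cm·γ³·θ^{kₑ}(kₑ(1−θ)+θ)∕(1−θ)²`
# at every pin, UNIFORMLY IN THE RANGE `K` (**`old_tail_load_le_of_envelope`**, **`old_tail_load_le_geometric`**; the box `h ≤ γ`; §1 is the tail algebra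
# `Σ_{k≥n} kθ^k = θ^n(n(1−θ)+θ)∕(1−θ)²`), while the young cluster `[1,kₑ)` carries at most `(√2∕2)(1 + ⅛·log(kₑ∕2))` at every pin by (E112b)
# `cluster_load_le_log` — or whatever a finite-range certificate gives (socket **`total_load_le_of_young_and_tail`**).  Hence the light-load END of (E89b) at
# EVERY range: **`flow_nonneg_of_young_certificate_envelope`** (socket: any young-cluster certificate with margin `δ`, any envelope with tail `≤ δ`) and,
# discharged by (E112b), **`flow_nonneg_of_geometric_envelope`**: `B` an isotone memory with floor `b > 0` dominating `L ≥ 0` on the ages `< K` — ANY `K` —,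
# `L_k ≤ Cm·θ^k` for `k ≥ kₑ` (`kₑ ≥ 2`, `0 ≤ θ < 1`, `Cm ≥ 0`), `h` a box solution in `]0,γ]`, and the displayed inequality
#     `(√2∕2)(1 + (log kₑ − log 2)∕8) + ½·Cm·γ³·θ^{kₑ}(kₑ(1−θ)+θ)∕(1−θ)² ≤ 1`
# ⟹ `0 ≤ ε ≤ e` for every admissible excess, every damping `0 < g ≤ 1`, every horizon.  Instances: **`flow_nonneg_of_envelope_half`** (`θ ≤ ½`, `Cm·γ³ ≤
# 6·10⁶`; `kₑ = 32`) and **`flow_nonneg_of_envelope_three_quarters`** (`θ ≤ ¾`, `Cm·γ³ ≤ 100`; `kₑ = 48`).  READING (README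
# `HOME/b2b-balaban-beta-d4-p2/g95/README.md`): the range-free END exists exactly where physics puts it — for fading memory —, with the young-range frontier of
# the census (`[1,53]`, (E112a)) as the only input; every future finite-range theorem with margin plugs into the socket and relaxes the displayed inequality
# (README §3 tabulates the admissible `Cm·γ³` against `θ` for the typed bound and for the numerical young frontier).  The every-range END WITHOUT an envelope is
# NOT a target: README §2 (continuum top-heavy rows: the END itself fails from row mass `≈ 1.75–2.5` on, i.e. at spans `≳ 2^45`, beyond kernel witnesses).

Cell `pub-balaban`, β-function sub-cell, BINDER row D4 «RemainderConst leaves for Bałaban's split» (`HOME/BINDER-OWNERS.md`; owner lineage `b2b-balaban-beta-an4`;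
this file by co-owner #2 lineage `b2b-balaban-beta-d4-p2`, generation 95), β-FLOW TEAM duty (1), FREEZE (0) honoured (def-free; imports (E112b); uses (E112b)
`cluster_load_le_log`, `sqrt_two_div_two_le`, `log_three_le`, (E89b) `flow_nonneg_of_window_loads_le_one` BY NAME; the display of `KL`, `KA`, `RA` is (E86i)'s
VERBATIM; nothing restated).

HONEST FRAMING (page 1, verbatim and binding).  *"Discharging BetaPertH makes Bałaban's UV stability UNCONDITIONAL — a real constructive-QFT result; it is
NOT the continuum limit and NOT the Clay problem."*  THIS FILE DISCHARGES NOTHING OF THE KIND.  Elementary real analysis about ABSTRACT functionals on a box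
]0,γ]^ℕ with displayed floors, profiles, envelopes and signs, and the FIRST-ORDER renewal objects of route (N) built from them — hypotheses of a census, not
facts; the form, signs, ages, moments and memory profile of Bałaban's (1.22) limit functional are NOT PRINTED ([I] p. 298; GAPS G-t4-U2-1∕-2) and NOT asserted.
Row D4 class UNCHANGED (critical-path width 0; instance 0∕1; D4 DISCHARGE NO DATE).  HONEST DEPENDENCY: continuum YM on T⁴ ⇐ BetaPertH ∧ nine spine estimates
(0/9 proved); BetaPertH ⇐ (D1) ∧ (D4) ∧ CAP+tail; G-an2-4 gates asym, D1 and NE2/3/4.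

NOT CLAIMED: the END without an envelope at every range (README g95 §2: predicted FALSE, not witnessed); any improvement of the young-range frontier `[1,53]`;
anything printed — NOT B12 Thm 2, NOT BetaPertH, NOT continuum, NOT Clay.

WHAT IS PROVED ([folklore]; 0 `def`, 0 sorry).  §1 `geom_tail_step`, `sum_Ico_mul_geom_eq`, **`sum_Ico_mul_geom_le`**.  §2 **`old_tail_load_le_of_envelope`**,
**`old_tail_load_le_geometric`**.  §3 `young_cluster_load_eq`, **`total_load_le_of_young_and_tail`**, **`flow_nonneg_of_young_certificate_envelope`**.
§4 `young_cluster_le_log`, **`total_load_le_one_of_geometric_envelope`**, **`flow_nonneg_of_geometric_envelope`**.  §5 `log_sixteen_le`, `log_twentyfour_le`,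
**`flow_nonneg_of_envelope_half`**, **`flow_nonneg_of_envelope_three_quarters`**.
-/
noncomputable section
open Finset

namespace Summit.QuantumFields.BalabanUV.Beta.EriceRemainderEnclosureHistoryAutonomyComparisonAgeCompositionFadingEnvelope

open Literature.MathematicalPhysics.QuantumFieldTheory.Balaban1983to89
open Literature.MathematicalPhysics.QuantumFieldTheory.Balaban1983to89.T4BetaStationary
open Literature.MathematicalPhysics.QuantumFieldTheory.Balaban1983to89.T4BetaFlowWellPosed
open Summit.QuantumFields.BalabanUV.Beta.EriceRemainderEnclosureHistoryAutonomyComparisonAgeCompositionThreeAgesMassCap (flow_nonneg_of_window_loads_le_one)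
open Summit.QuantumFields.BalabanUV.Beta.EriceRemainderEnclosureHistoryAutonomyComparisonAgeCompositionAgeRatioWindowClusters
  (cluster_load_le_log sqrt_two_div_two_le log_three_le)

variable {B : (ℕ → ℝ) → ℝ} {γ b gIR : ℝ} {L : ℕ → ℝ} {K : ℕ} {h g : ℕ → ℝ}

/-! ## §1 Tail algebra: `Σ_{k ≥ n} k·θ^k = θ^n·(n(1−θ)+θ)∕(1−θ)²` -/

/-- The closed form `G n = θ^n(n(1−θ)+θ)∕(1−θ)²` steps down by exactly `n·θ^n`: `G n − G (n+1) = n·θ^n` (`θ ≠ 1`). [folklore] -/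
theorem geom_tail_step {θ : ℝ} (hθ1 : θ ≠ 1) (n : ℕ) :
    θ ^ n * ((n : ℝ) * (1 - θ) + θ) / (1 - θ) ^ 2 - θ ^ (n + 1) * (((n : ℝ) + 1) * (1 - θ) + θ) / (1 - θ) ^ 2 = (n : ℝ) * θ ^ n := by
  have h1 : (1 - θ) ≠ 0 := sub_ne_zero.mpr (Ne.symm hθ1)
  field_simp
  ring

/-- Telescoping: `Σ_{k ∈ [n,N)} k·θ^k = G n − G N` for `n ≤ N` (`θ ≠ 1`). [folklore] -/
theorem sum_Ico_mul_geom_eq {θ : ℝ} (hθ1 : θ ≠ 1) {n N : ℕ} (hnN : n ≤ N) :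
    ∑ k ∈ Ico n N, (k : ℝ) * θ ^ k
      = θ ^ n * ((n : ℝ) * (1 - θ) + θ) / (1 - θ) ^ 2 - θ ^ N * ((N : ℝ) * (1 - θ) + θ) / (1 - θ) ^ 2 := by
  induction N, hnN using Nat.le_induction with
  | base => simp
  | succ N hnN ih =>
    rw [sum_Ico_succ_top hnN, ih]
    have hstep := geom_tail_step hθ1 N
    push_cast
    linear_combination -hstep

/-- **THE GEOMETRIC TAIL BOUND**: for `0 ≤ θ < 1` and all `n, N`, `Σ_{k ∈ [n,N)} k·θ^k ≤ θ^n·(n(1−θ)+θ)∕(1−θ)²` — uniformly in `N`. [folklore] -/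
theorem sum_Ico_mul_geom_le {θ : ℝ} (hθ0 : 0 ≤ θ) (hθ1 : θ < 1) (n N : ℕ) :
    ∑ k ∈ Ico n N, (k : ℝ) * θ ^ k ≤ θ ^ n * ((n : ℝ) * (1 - θ) + θ) / (1 - θ) ^ 2 := by
  rcases Nat.lt_or_ge N n with hNn | hnN
  · rw [Ico_eq_empty (by omega), sum_empty]
    have : 0 ≤ (n : ℝ) * (1 - θ) + θ := by have := Nat.cast_nonneg (α := ℝ) n; nlinarith
    positivity
  · rw [sum_Ico_mul_geom_eq hθ1.ne hnN]
    have hGN : 0 ≤ θ ^ N * ((N : ℝ) * (1 - θ) + θ) / (1 - θ) ^ 2 := by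
      have : 0 ≤ (N : ℝ) * (1 - θ) + θ := by have := Nat.cast_nonneg (α := ℝ) N; nlinarith
      positivity
    linarith

/-! ## §2 The old tail of the total window load under an envelope -/

/-- **THE OLD TAIL UNDER AN ENVELOPE.**  `L ≥ 0`, `h` in the box `]0,γ]`, `L_k ≤ Λ_k` for `k ≥ kₑ`.  Then at every pin and for EVERY range `K`:
`Σ_{kₑ ≤ k < K} k·L_kh(m+k)³∕2 ≤ (γ³∕2)·Σ_{kₑ ≤ k < K} k·Λ_k`. [folklore] -/
theorem old_tail_load_le_of_envelope (hL : ∀ k, 0 ≤ L k) (hh : SeqBox γ h) {Λ : ℕ → ℝ} {kₑ : ℕ} (henv : ∀ k, kₑ ≤ k → L k ≤ Λ k) (m : ℕ) :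
    ∑ k ∈ Ico kₑ K, (k : ℝ) * (L k * h (m + k) ^ 3 / 2) ≤ γ ^ 3 / 2 * ∑ k ∈ Ico kₑ K, (k : ℝ) * Λ k := by
  rw [mul_sum]
  refine sum_le_sum fun k hk => ?_
  have hke : kₑ ≤ k := (mem_Ico.mp hk).1
  have h0 := (hh (m + k)).1
  have hγ := (hh (m + k)).2
  have hcube : h (m + k) ^ 3 ≤ γ ^ 3 := pow_le_pow_left₀ h0.le hγ 3
  have hΛ : 0 ≤ Λ k := (hL k).trans (henv k hke)
  have h1 : L k * h (m + k) ^ 3 ≤ Λ k * γ ^ 3 := mul_le_mul (henv k hke) hcube (by positivity) hΛ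
  have hk0 : (0 : ℝ) ≤ k := Nat.cast_nonneg k
  calc (k : ℝ) * (L k * h (m + k) ^ 3 / 2) ≤ (k : ℝ) * (Λ k * γ ^ 3 / 2) := mul_le_mul_of_nonneg_left (by linarith) hk0
    _ = γ ^ 3 / 2 * ((k : ℝ) * Λ k) := by ring

/-- **THE OLD TAIL UNDER A GEOMETRIC ENVELOPE** (`L_k ≤ Cm·θ^k` for `k ≥ kₑ`, `0 ≤ θ < 1`, `Cm ≥ 0`): at every pin and for EVERY range `K`,
`Σ_{kₑ ≤ k < K} k·L_kh(m+k)³∕2 ≤ ½·Cm·γ³·θ^{kₑ}(kₑ(1−θ)+θ)∕(1−θ)²`. [folklore] -/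
theorem old_tail_load_le_geometric (hL : ∀ k, 0 ≤ L k) (hh : SeqBox γ h) {Cm θ : ℝ} {kₑ : ℕ} (hCm : 0 ≤ Cm) (hθ0 : 0 ≤ θ) (hθ1 : θ < 1)
    (henv : ∀ k, kₑ ≤ k → L k ≤ Cm * θ ^ k) (m : ℕ) :
    ∑ k ∈ Ico kₑ K, (k : ℝ) * (L k * h (m + k) ^ 3 / 2)
      ≤ Cm * γ ^ 3 / 2 * (θ ^ kₑ * ((kₑ : ℝ) * (1 - θ) + θ) / (1 - θ) ^ 2) := by
  have hγ : 0 < γ := (hh 0).1.trans_le (hh 0).2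
  have h1 := old_tail_load_le_of_envelope (K := K) hL hh henv m
  have h2 : ∑ k ∈ Ico kₑ K, (k : ℝ) * (Cm * θ ^ k) = Cm * ∑ k ∈ Ico kₑ K, (k : ℝ) * θ ^ k := by
    rw [mul_sum]; exact sum_congr rfl fun k _ => by ring
  rw [h2] at h1
  have h3 := mul_le_mul_of_nonneg_left (sum_Ico_mul_geom_le hθ0 hθ1 kₑ K) hCm
  calc ∑ k ∈ Ico kₑ K, (k : ℝ) * (L k * h (m + k) ^ 3 / 2) ≤ γ ^ 3 / 2 * (Cm * ∑ k ∈ Ico kₑ K, (k : ℝ) * θ ^ k) := h1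
    _ ≤ γ ^ 3 / 2 * (Cm * (θ ^ kₑ * ((kₑ : ℝ) * (1 - θ) + θ) / (1 - θ) ^ 2)) := mul_le_mul_of_nonneg_left h3 (by positivity)
    _ = Cm * γ ^ 3 / 2 * (θ ^ kₑ * ((kₑ : ℝ) * (1 - θ) + θ) / (1 - θ) ^ 2) := by ring

/-! ## §3 Young cluster plus old tail: the socket, and the END at every range -/

/-- The ages below `kₑ` are the young cluster `[1,kₑ)` (the age `0` carries nothing). [folklore] -/
theorem young_cluster_load_eq (f : ℕ → ℝ) (kₑ : ℕ) :
    ∑ k ∈ range kₑ, (k : ℝ) * f k = ∑ k ∈ Ico 1 kₑ, (k : ℝ) * f k := by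
  rcases Nat.eq_zero_or_pos kₑ with rfl | hpos
  · simp
  · rw [range_eq_Ico, sum_eq_sum_Ico_succ_bot hpos]
    simp

/-- **THE SOCKET.**  `kₑ ≤ K`; a young-cluster certificate `Σ_{1 ≤ k < kₑ} k·L_kh(m+k)³∕2 ≤ 1 − δ` and an old-tail bound `Σ_{kₑ ≤ k < K} k·L_kh(m+k)³∕2 ≤ δ` at the
pin `m` give the light load `Σ_{k<K} k·L_kh(m+k)³∕2 ≤ 1` there. [folklore] -/
theorem total_load_le_of_young_and_tail {kₑ : ℕ} (hkK : kₑ ≤ K) (m : ℕ) {δ : ℝ}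
    (hyoung : ∑ k ∈ Ico 1 kₑ, (k : ℝ) * (L k * h (m + k) ^ 3 / 2) ≤ 1 - δ)
    (htail : ∑ k ∈ Ico kₑ K, (k : ℝ) * (L k * h (m + k) ^ 3 / 2) ≤ δ) :
    ∑ k ∈ range K, (k : ℝ) * (L k * h (m + k) ^ 3 / 2) ≤ 1 := by
  rw [← sum_range_add_sum_Ico _ hkK, young_cluster_load_eq (fun k => L k * h (m + k) ^ 3 / 2) kₑ]
  linarith

/-- **ROUTE (N), FIRST ORDER — THE END AT EVERY RANGE FROM A YOUNG CERTIFICATE AND AN ENVELOPE (SOCKET).**  `L ≥ 0` on the ages `< K` (`1 ≤ K`, ANY `K`),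
`h` a box history in `]0,γ]`, `g` a damping with `0 < g ≤ 1`, `KL`, `KA`, `RA` as displayed ((E86i) verbatim), horizon `N ≥ K`; an age `kₑ ≤ K`, a margin `δ`,
a young-cluster certificate `Σ_{1≤k<kₑ} k·L_kh(m+k)³∕2 ≤ 1 − δ` at every pin (ANY finite-range theorem of the census), and an envelope `L_k ≤ Λ_k` (`k ≥ kₑ`) with
`(γ³∕2)·Σ_{kₑ≤k<K} k·Λ_k ≤ δ`.  THEN `0 ≤ ε m ≤ e m` at every pin for every admissible excess. [folklore] -/
theorem flow_nonneg_of_young_certificate_envelope (hL : ∀ k, 0 ≤ L k) (hh : SeqBox γ h) (hg : ∀ t, 0 < g t ∧ g t ≤ 1) (hK : 1 ≤ K)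
    {N : ℕ} (hKN : K ≤ N) {kₑ : ℕ} (hkK : kₑ ≤ K) {δ : ℝ}
    (hyoung : ∀ m, ∑ k ∈ Ico 1 kₑ, (k : ℝ) * (L k * h (m + k) ^ 3 / 2) ≤ 1 - δ)
    {Λ : ℕ → ℝ} (henv : ∀ k, kₑ ≤ k → L k ≤ Λ k) (hΛ : γ ^ 3 / 2 * ∑ k ∈ Ico kₑ K, (k : ℝ) * Λ k ≤ δ)
    {KL : ℕ → ℕ → ℕ → ℝ}
    (hKL : ∀ k n l, KL k n l = if 0 < k ∧ k < K ∧ l < k then L k * h (n + k) ^ 3 / 2 * ∏ t ∈ Ico (n + 1 + l) (n + k + 1), g t else 0)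
    {KA : ℕ → ℕ → ℕ → ℝ} {RA : ℕ → (ℕ → ℝ) → ℕ → ℝ}
    (hRA : ∀ i v m, RA i v m = ∑ l ∈ range K, KA i m l * v (m + 1 + l))
    (hKA : ∀ i m l, KA i m l = KL i m l + KA (i + 1) m l) (hKAtop : ∀ m l, KA K m l = 0)
    {e ε : ℕ → ℝ} (he0 : ∀ m, 0 ≤ e m) (hea : ∀ m, e (m + 1) ≤ e m)
    (hεt : ∀ m, N < m → ε m = 0) (hεrec : ∀ m, ε m = e m - RA 1 ε m) : ∀ m, 0 ≤ ε m ∧ ε m ≤ e m :=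
  flow_nonneg_of_window_loads_le_one hL hh hg hK hKN hKL hRA hKA hKAtop
    (fun m => total_load_le_of_young_and_tail hkK m (hyoung m) ((old_tail_load_le_of_envelope hL hh henv m).trans hΛ))
    he0 hea hεt hεrec

/-! ## §4 Discharged by (E112b): the END at every range under a geometric envelope -/

/-- **THE YOUNG CLUSTER BY THE LOGARITHMIC WINDOW BOUND** ((E112b) `cluster_load_le_log` with `k₀ = 1`): for `2 ≤ K' ≤ K` and `K' ≤ kₑ`,
`Σ_{1≤k<K'} k·L_kh(m+k)³∕2 ≤ (√2∕2)(1 + (log kₑ − log 2)∕8)`. [folklore] -/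
theorem young_cluster_le_log (hmono : ∀ u v : ℕ → ℝ, SeqBox γ u → SeqBox γ v → (∀ j, u j ≤ v j) → B u ≤ B v)
    (hL : ∀ k, 0 ≤ L k) (hb : 0 < b) (hlo : ∀ u, SeqBox γ u → b ≤ B u) (hdom : ∀ u, SeqBox γ u → ∑ k ∈ range K, L k * u k ≤ B u)
    (hh : SeqBox γ h) (hf : MemFlow B gIR h) {K' kₑ : ℕ} (hK' : 2 ≤ K') (hK'K : K' ≤ K) (hK'e : K' ≤ kₑ) (m : ℕ) :
    ∑ k ∈ Ico 1 K', (k : ℝ) * (L k * h (m + k) ^ 3 / 2) ≤ Real.sqrt 2 / 2 * (1 + (Real.log kₑ - Real.log 2) / 8) := by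
  have h1 := cluster_load_le_log hmono hL hb hlo hdom hh hf (k₀ := 1) le_rfl (by omega) hK'K m
  simp only [Nat.cast_one, add_sub_cancel_left, mul_one] at h1
  have hlog : Real.log (K' : ℝ) ≤ Real.log (kₑ : ℝ) :=
    Real.log_le_log (by exact_mod_cast (show 0 < K' by omega)) (by exact_mod_cast hK'e)
  have hs : 0 ≤ Real.sqrt 2 / 2 := by positivity
  calc ∑ k ∈ Ico 1 K', (k : ℝ) * (L k * h (m + k) ^ 3 / 2) ≤ Real.sqrt 2 / 2 * (1 + (Real.log K' - Real.log 2) / 8) := h1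
    _ ≤ Real.sqrt 2 / 2 * (1 + (Real.log kₑ - Real.log 2) / 8) := mul_le_mul_of_nonneg_left (by linarith) hs

/-- **THE LIGHT LOAD AT EVERY RANGE UNDER A GEOMETRIC ENVELOPE.**  `B` isotone with floor `b > 0` dominating `L ≥ 0` on the ages `< K` (ANY `K`), `h` a box
solution in `]0,γ]`; `L_k ≤ Cm·θ^k` for `k ≥ kₑ` (`kₑ ≥ 2`, `0 ≤ θ < 1`, `Cm ≥ 0`) and
`(√2∕2)(1 + (log kₑ − log 2)∕8) + ½·Cm·γ³·θ^{kₑ}(kₑ(1−θ)+θ)∕(1−θ)² ≤ 1`.  Then `Σ_{k<K} k·L_kh(m+k)³∕2 ≤ 1` at every pin. [folklore] -/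
theorem total_load_le_one_of_geometric_envelope (hmono : ∀ u v : ℕ → ℝ, SeqBox γ u → SeqBox γ v → (∀ j, u j ≤ v j) → B u ≤ B v)
    (hL : ∀ k, 0 ≤ L k) (hb : 0 < b) (hlo : ∀ u, SeqBox γ u → b ≤ B u) (hdom : ∀ u, SeqBox γ u → ∑ k ∈ range K, L k * u k ≤ B u)
    (hh : SeqBox γ h) (hf : MemFlow B gIR h) {Cm θ : ℝ} {kₑ : ℕ} (hkₑ : 2 ≤ kₑ) (hCm : 0 ≤ Cm) (hθ0 : 0 ≤ θ) (hθ1 : θ < 1)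
    (henv : ∀ k, kₑ ≤ k → L k ≤ Cm * θ ^ k)
    (hineq : Real.sqrt 2 / 2 * (1 + (Real.log kₑ - Real.log 2) / 8) + Cm * γ ^ 3 / 2 * (θ ^ kₑ * ((kₑ : ℝ) * (1 - θ) + θ) / (1 - θ) ^ 2) ≤ 1)
    (m : ℕ) : ∑ k ∈ range K, (k : ℝ) * (L k * h (m + k) ^ 3 / 2) ≤ 1 := by
  have hγ : 0 < γ := (hh 0).1.trans_le (hh 0).2
  have htail0 : 0 ≤ Cm * γ ^ 3 / 2 * (θ ^ kₑ * ((kₑ : ℝ) * (1 - θ) + θ) / (1 - θ) ^ 2) := by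
    have : 0 ≤ (kₑ : ℝ) * (1 - θ) + θ := by have := Nat.cast_nonneg (α := ℝ) kₑ; nlinarith
    positivity
  rcases Nat.lt_or_ge K kₑ with hKk | hkK
  swap
  · -- young cluster `[1,kₑ)` + old tail `[kₑ,K)`
    exact total_load_le_of_young_and_tail (δ := Cm * γ ^ 3 / 2 * (θ ^ kₑ * ((kₑ : ℝ) * (1 - θ) + θ) / (1 - θ) ^ 2)) hkK m
      ((young_cluster_le_log hmono hL hb hlo hdom hh hf hkₑ hkK le_rfl m).trans (by linarith))
      (old_tail_load_le_geometric (K := K) hL hh hCm hθ0 hθ1 henv m)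
  · -- the whole profile is young: `K < kₑ`
    rcases Nat.lt_or_ge K 2 with hK2 | hK2
    · -- `K ≤ 1`: no loaded age
      have hK' : range K ⊆ {0} := fun k hk => by rw [mem_singleton]; have := mem_range.mp hk; omega
      calc ∑ k ∈ range K, (k : ℝ) * (L k * h (m + k) ^ 3 / 2) ≤ ∑ k ∈ ({0} : Finset ℕ), (k : ℝ) * (L k * h (m + k) ^ 3 / 2) :=
            sum_le_sum_of_subset_of_nonneg hK' fun k _ _ => by
              have := hL k; have := (hh (m + k)).1; positivity
        _ ≤ 1 := by simp
    · rw [young_cluster_load_eq (fun k => L k * h (m + k) ^ 3 / 2) K]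
      exact (young_cluster_le_log hmono hL hb hlo hdom hh hf hK2 le_rfl hKk.le m).trans (by linarith)

/-- **ROUTE (N), FIRST ORDER — FADING MEMORY BUYS EVERY RANGE.**  `B` an isotone memory on the box with floor `b > 0` dominating the profile `L ≥ 0` on the
ages `< K` — ANY range `K ≥ 1` —; `L_k ≤ Cm·θ^k` for every `k ≥ kₑ` (`kₑ ≥ 2`, `0 ≤ θ < 1`, `Cm ≥ 0`: a GEOMETRIC ENVELOPE from the age `kₑ` on); `h` a box
solution in `]0,γ]` from any pin; ANY damping `0 < g ≤ 1`; ANY horizon `N ≥ K`; `KL`, `KA`, `RA` as displayed; and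
`(√2∕2)(1 + (log kₑ − log 2)∕8) + ½·Cm·γ³·θ^{kₑ}(kₑ(1−θ)+θ)∕(1−θ)² ≤ 1`.  THEN the comparison surplus of every admissible excess satisfies `0 ≤ ε m ≤ e m` at
every pin. [folklore] -/
theorem flow_nonneg_of_geometric_envelope (hmono : ∀ u v : ℕ → ℝ, SeqBox γ u → SeqBox γ v → (∀ j, u j ≤ v j) → B u ≤ B v)
    (hL : ∀ k, 0 ≤ L k) (hb : 0 < b) (hlo : ∀ u, SeqBox γ u → b ≤ B u) (hdom : ∀ u, SeqBox γ u → ∑ k ∈ range K, L k * u k ≤ B u)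
    (hh : SeqBox γ h) (hf : MemFlow B gIR h) (hg : ∀ t, 0 < g t ∧ g t ≤ 1) (hK : 1 ≤ K) {N : ℕ} (hKN : K ≤ N)
    {Cm θ : ℝ} {kₑ : ℕ} (hkₑ : 2 ≤ kₑ) (hCm : 0 ≤ Cm) (hθ0 : 0 ≤ θ) (hθ1 : θ < 1) (henv : ∀ k, kₑ ≤ k → L k ≤ Cm * θ ^ k)
    (hineq : Real.sqrt 2 / 2 * (1 + (Real.log kₑ - Real.log 2) / 8) + Cm * γ ^ 3 / 2 * (θ ^ kₑ * ((kₑ : ℝ) * (1 - θ) + θ) / (1 - θ) ^ 2) ≤ 1)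
    {KL : ℕ → ℕ → ℕ → ℝ}
    (hKL : ∀ k n l, KL k n l = if 0 < k ∧ k < K ∧ l < k then L k * h (n + k) ^ 3 / 2 * ∏ t ∈ Ico (n + 1 + l) (n + k + 1), g t else 0)
    {KA : ℕ → ℕ → ℕ → ℝ} {RA : ℕ → (ℕ → ℝ) → ℕ → ℝ}
    (hRA : ∀ i v m, RA i v m = ∑ l ∈ range K, KA i m l * v (m + 1 + l))
    (hKA : ∀ i m l, KA i m l = KL i m l + KA (i + 1) m l) (hKAtop : ∀ m l, KA K m l = 0)
    {e ε : ℕ → ℝ} (he0 : ∀ m, 0 ≤ e m) (hea : ∀ m, e (m + 1) ≤ e m)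
    (hεt : ∀ m, N < m → ε m = 0) (hεrec : ∀ m, ε m = e m - RA 1 ε m) : ∀ m, 0 ≤ ε m ∧ ε m ≤ e m :=
  flow_nonneg_of_window_loads_le_one hL hh hg hK hKN hKL hRA hKA hKAtop
    (total_load_le_one_of_geometric_envelope hmono hL hb hlo hdom hh hf hkₑ hCm hθ0 hθ1 henv hineq) he0 hea hεt hεrec

/-! ## §5 Instances: `θ ≤ ½` and `θ ≤ ¾` -/

/-- `log 16 ≤ 2.7725888` (`4·log 2`). [folklore] -/
theorem log_sixteen_le : Real.log 16 ≤ 2.7725888 := by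
  rw [show (16 : ℝ) = 2 ^ 4 by norm_num, Real.log_pow]
  have := Real.log_two_lt_d9
  push_cast
  linarith

/-- `log 24 ≤ 3.18` (`3·log 2 + log 3`). [folklore] -/
theorem log_twentyfour_le : Real.log 24 ≤ 3.18 := by
  rw [show (24 : ℝ) = 2 ^ 3 * 3 by norm_num, Real.log_mul (by norm_num) (by norm_num), Real.log_pow]
  have := Real.log_two_lt_d9
  have := log_three_le
  push_cast
  linarith

/-- **INSTANCE `θ ≤ ½`**: a geometric envelope `L_k ≤ Cm·θ^k` from the age `32` on with `0 ≤ θ ≤ ½` and `Cm·γ³ ≤ 6·10⁶` gives the END at EVERY range (the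
displayed inequality at `kₑ = 32`: `0.9522 + 3·10⁶·66∕2³² ≤ 1`). [folklore] -/
theorem flow_nonneg_of_envelope_half (hmono : ∀ u v : ℕ → ℝ, SeqBox γ u → SeqBox γ v → (∀ j, u j ≤ v j) → B u ≤ B v)
    (hL : ∀ k, 0 ≤ L k) (hb : 0 < b) (hlo : ∀ u, SeqBox γ u → b ≤ B u) (hdom : ∀ u, SeqBox γ u → ∑ k ∈ range K, L k * u k ≤ B u)
    (hh : SeqBox γ h) (hf : MemFlow B gIR h) (hg : ∀ t, 0 < g t ∧ g t ≤ 1) (hK : 1 ≤ K) {N : ℕ} (hKN : K ≤ N)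
    {Cm θ : ℝ} (hCm : 0 ≤ Cm) (hθ0 : 0 ≤ θ) (hθ : θ ≤ 1 / 2) (henv : ∀ k, 32 ≤ k → L k ≤ Cm * θ ^ k) (hC : Cm * γ ^ 3 ≤ 6000000)
    {KL : ℕ → ℕ → ℕ → ℝ}
    (hKL : ∀ k n l, KL k n l = if 0 < k ∧ k < K ∧ l < k then L k * h (n + k) ^ 3 / 2 * ∏ t ∈ Ico (n + 1 + l) (n + k + 1), g t else 0)
    {KA : ℕ → ℕ → ℕ → ℝ} {RA : ℕ → (ℕ → ℝ) → ℕ → ℝ}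
    (hRA : ∀ i v m, RA i v m = ∑ l ∈ range K, KA i m l * v (m + 1 + l))
    (hKA : ∀ i m l, KA i m l = KL i m l + KA (i + 1) m l) (hKAtop : ∀ m l, KA K m l = 0)
    {e ε : ℕ → ℝ} (he0 : ∀ m, 0 ≤ e m) (hea : ∀ m, e (m + 1) ≤ e m)
    (hεt : ∀ m, N < m → ε m = 0) (hεrec : ∀ m, ε m = e m - RA 1 ε m) : ∀ m, 0 ≤ ε m ∧ ε m ≤ e m := by
  have hγ : 0 < γ := (hh 0).1.trans_le (hh 0).2
  -- pass to the envelope `Cm·(½)^k`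
  have henv' : ∀ k, 32 ≤ k → L k ≤ Cm * (1 / 2 : ℝ) ^ k := fun k hk =>
    (henv k hk).trans (mul_le_mul_of_nonneg_left (pow_le_pow_left₀ hθ0 hθ k) hCm)
  refine flow_nonneg_of_geometric_envelope hmono hL hb hlo hdom hh hf hg hK hKN (kₑ := 32) (by norm_num) hCm (by norm_num)
    (by norm_num) henv' ?_ hKL hRA hKA hKAtop he0 hea hεt hεrec
  have hs := sqrt_two_div_two_le
  have hl2 := Real.log_two_gt_d9
  have hl2' := Real.log_two_lt_d9
  have hl32 : Real.log (32 : ℝ) = (5 : ℕ) * Real.log 2 := by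
    rw [show (32 : ℝ) = 2 ^ 5 by norm_num, Real.log_pow]
  have hyoung : Real.sqrt 2 / 2 * (1 + (Real.log (32 : ℝ) - Real.log 2) / 8) ≤ 0.9522 := by
    rw [hl32]
    push_cast
    have h1 : 1 + (5 * Real.log 2 - Real.log 2) / 8 ≤ 1.34658 := by linarith
    have h0 : 0 ≤ 1 + (5 * Real.log 2 - Real.log 2) / 8 := by linarith
    calc Real.sqrt 2 / 2 * (1 + (5 * Real.log 2 - Real.log 2) / 8) ≤ 0.7071068 * 1.34658 := mul_le_mul hs h1 h0 (by norm_num)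
      _ ≤ 0.9522 := by norm_num
  have hCγ : 0 ≤ Cm * γ ^ 3 := by positivity
  have e : ((1 / 2 : ℝ) ^ (32 : ℕ) * ((32 : ℝ) * (1 - 1 / 2) + 1 / 2) / (1 - 1 / 2) ^ 2) = 66 / 4294967296 := by norm_num
  simp only [Nat.cast_ofNat]
  rw [e]
  nlinarith

/-- **INSTANCE `θ ≤ ¾`**: a geometric envelope `L_k ≤ Cm·θ^k` from the age `48` on with `0 ≤ θ ≤ ¾` and `Cm·γ³ ≤ 100` gives the END at EVERY range (the
displayed inequality at `kₑ = 48`: `0.9882 + 50·(¾)^48·12.75·16 ≤ 1`). [folklore] -/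
theorem flow_nonneg_of_envelope_three_quarters (hmono : ∀ u v : ℕ → ℝ, SeqBox γ u → SeqBox γ v → (∀ j, u j ≤ v j) → B u ≤ B v)
    (hL : ∀ k, 0 ≤ L k) (hb : 0 < b) (hlo : ∀ u, SeqBox γ u → b ≤ B u) (hdom : ∀ u, SeqBox γ u → ∑ k ∈ range K, L k * u k ≤ B u)
    (hh : SeqBox γ h) (hf : MemFlow B gIR h) (hg : ∀ t, 0 < g t ∧ g t ≤ 1) (hK : 1 ≤ K) {N : ℕ} (hKN : K ≤ N)
    {Cm θ : ℝ} (hCm : 0 ≤ Cm) (hθ0 : 0 ≤ θ) (hθ : θ ≤ 3 / 4) (henv : ∀ k, 48 ≤ k → L k ≤ Cm * θ ^ k) (hC : Cm * γ ^ 3 ≤ 100)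
    {KL : ℕ → ℕ → ℕ → ℝ}
    (hKL : ∀ k n l, KL k n l = if 0 < k ∧ k < K ∧ l < k then L k * h (n + k) ^ 3 / 2 * ∏ t ∈ Ico (n + 1 + l) (n + k + 1), g t else 0)
    {KA : ℕ → ℕ → ℕ → ℝ} {RA : ℕ → (ℕ → ℝ) → ℕ → ℝ}
    (hRA : ∀ i v m, RA i v m = ∑ l ∈ range K, KA i m l * v (m + 1 + l))
    (hKA : ∀ i m l, KA i m l = KL i m l + KA (i + 1) m l) (hKAtop : ∀ m l, KA K m l = 0)
    {e ε : ℕ → ℝ} (he0 : ∀ m, 0 ≤ e m) (hea : ∀ m, e (m + 1) ≤ e m)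
    (hεt : ∀ m, N < m → ε m = 0) (hεrec : ∀ m, ε m = e m - RA 1 ε m) : ∀ m, 0 ≤ ε m ∧ ε m ≤ e m := by
  have hγ : 0 < γ := (hh 0).1.trans_le (hh 0).2
  have henv' : ∀ k, 48 ≤ k → L k ≤ Cm * (3 / 4 : ℝ) ^ k := fun k hk =>
    (henv k hk).trans (mul_le_mul_of_nonneg_left (pow_le_pow_left₀ hθ0 hθ k) hCm)
  refine flow_nonneg_of_geometric_envelope hmono hL hb hlo hdom hh hf hg hK hKN (kₑ := 48) (by norm_num) hCm (by norm_num)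
    (by norm_num) henv' ?_ hKL hRA hKA hKAtop he0 hea hεt hεrec
  have hs := sqrt_two_div_two_le
  have hl2 := Real.log_two_gt_d9
  have hl2' := Real.log_two_lt_d9
  have hl48 : Real.log (48 : ℝ) = Real.log 2 + Real.log 24 := by
    rw [show (48 : ℝ) = 2 * 24 by norm_num, Real.log_mul (by norm_num) (by norm_num)]
  have hl24 := log_twentyfour_le
  have hyoung : Real.sqrt 2 / 2 * (1 + (Real.log (48 : ℝ) - Real.log 2) / 8) ≤ 0.98822 := by
    rw [hl48]
    have h1 : 1 + (Real.log 2 + Real.log 24 - Real.log 2) / 8 ≤ 1.3975 := by linarith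
    have h0 : 0 ≤ 1 + (Real.log 2 + Real.log 24 - Real.log 2) / 8 := by
      have : 0 ≤ Real.log 24 := Real.log_nonneg (by norm_num)
      linarith
    calc Real.sqrt 2 / 2 * (1 + (Real.log 2 + Real.log 24 - Real.log 2) / 8) ≤ 0.7071068 * 1.3975 := mul_le_mul hs h1 h0 (by norm_num)
      _ ≤ 0.98822 := by norm_num
  have hCγ : 0 ≤ Cm * γ ^ 3 := by positivity
  have e : ((3 / 4 : ℝ) ^ (48 : ℕ) * ((48 : ℝ) * (1 - 3 / 4) + 3 / 4) / (1 - 3 / 4) ^ 2) ≤ 0.000206 := by norm_num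
  have e0 : 0 ≤ ((3 / 4 : ℝ) ^ (48 : ℕ) * ((48 : ℝ) * (1 - 3 / 4) + 3 / 4) / (1 - 3 / 4) ^ 2) := by norm_num
  simp only [Nat.cast_ofNat]
  nlinarith

end Summit.QuantumFields.BalabanUV.Beta.EriceRemainderEnclosureHistoryAutonomyComparisonAgeCompositionFadingEnvelope

end
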